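import Mathlib
import HarnessLib
import Literature.Analysis.FluidPDE.CKNLocalRegularityRRSPressure
import Summits.NavierStokesRegularity.NavierStokesRegularity.Theorems.QuarterLogPincerTypeIQuantSubcubicExpUnitScale

/-!
# Crux `QuarterLogPincer.TypeIQuantSubcubicExp` (stmt-NavierStokesRegularity-24077), line `thin_cascade`:
  clause `D` of `UniformScaledEnergy` at UNIT SCALE — the mean-oscillation of the pressure in `L^{3/2}`

Helper file (`--supports stmt-NavierStokesRegularity-24077 --as helper`, lead prover ns-tc-p1 g3) toward
the registered 4th stub `stub_uniformScaledEnergy : UniformScaledEnergy` (skeleton v5).  For a classical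
solution on `[0,T]` with uniformly `L²` slices (the used part of `TaoFrame`), the Type-I rate (`τ > 0`) and
`T ≥ 1`, and every centre `x`,

  `∫_{[T−1,T]} ∫_{B(x,1)} |p(t,y) − ⨍_{B(x,1)} p(t)|^{3/2} dy dt ≤ B_D(M)`     (`exists_unitScale_pressure_bound`)

with `B_D` a function of the Type-I constant alone.  On every interior slice `t ∈ (T−1,T)`: the
oscillation about the mean is `≤ 2√2 ×` the oscillation about any constant
(`RRS2016.lintegral_enorm_sub_setAverage_rpow_le`); the pressure is `Π[u(t)] + C(t)`
(`pressure_normalised_of_taoFrame`); the slice bound `exists_slice_pressure_bounds` with the pointwise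
weight `m(t)` and the uniform unit-ball energy bound `B(M)` of `exists_unitScale_energy_bounds` gives
`≲ K (m(t) B + B^{3/2})`; and `∫_{T−1}^{T} m ≤ 2|M|`.

HONEST FRAMING: one registered stub of an open crux is being assembled; nothing about Navier–Stokes
regularity is proved; no summit statement is proved by this file.
-/

noncomputable section

-- the summit-side namespace `Summit.NavierStokesRegularity.NavierStokesRegularity.…` (single-conjunct summit,
-- D-0017) repeats a component by design; the dupNamespace linter would flag every declaration.
set_option linter.dupNamespace false

namespace Summit.NavierStokesRegularity.NavierStokesRegularity.Theorems.ThinCascade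

open MeasureTheory Set Function Metric Filter Topology
open scoped ENNReal NNReal ContDiff
open Literature.Analysis Literature.Analysis.FluidPDE Literature.Analysis.FluidPDE.JiaSverak2013
open Summit.NavierStokesRegularity.NavierStokesRegularity.Cruxes.TypeIQuantSubcubicExp.ThinCascade
  (TaoFrame)

/-- **Clause `D` of `UniformScaledEnergy` at unit scale.**  There is `B_D : ℝ → ℝ`, `B_D ≥ 0`, such
that for every classical solution `(u, p)` on `[0,T]` with uniformly `L²` slices, the Type-I rate
`‖u(t,x)‖ ≤ M (T+τ−t)^{-1/2}` (`τ > 0`) and `T ≥ 1`, and every centre `x`: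
`∫_{[T−1,T]} ∫_{B(x,1)} |p(t,y) − ⨍_{B(x,1)} p(t)|^{3/2} dy dt ≤ B_D(M)`. [folklore] -/
theorem exists_unitScale_pressure_bound :
    ∃ BD : ℝ → ℝ, (∀ M, 0 ≤ BD M) ∧
      ∀ {M T τ : ℝ} {u : ℝ → EuclideanSpace ℝ (Fin 3) → EuclideanSpace ℝ (Fin 3)}
        {p : ℝ → EuclideanSpace ℝ (Fin 3) → ℝ}, IsClassicalNSSolutionOn (Icc 0 T) 1 0 u p →
        (∃ E₀ : ℝ≥0∞, E₀ ≠ ⊤ ∧ ∀ t ∈ Icc 0 T, ∫⁻ x, ‖u t x‖ₑ ^ 2 ≤ E₀) → 0 < τ →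
        (∀ t ∈ Icc 0 T, ∀ x, ‖u t x‖ ≤ M * (T + τ - t) ^ (-(1 / 2 : ℝ))) → 1 ≤ T →
        ∀ x : EuclideanSpace ℝ (Fin 3),
          ∫⁻ t in Icc (T - 1) T, ∫⁻ y in ball x 1,
              ENNReal.ofReal (|p t y - ⨍ z in ball x 1, p t z| ^ (3 / 2 : ℝ)) ≤
            ENNReal.ofReal (BD M) := by
  obtain ⟨B, hB0, hA⟩ := exists_unitScale_energy_bounds
  obtain ⟨K, hKtop, hK⟩ := exists_slice_pressure_bounds
  -- the constant, in `ℝ≥0∞` then in `ℝ`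
  set c₀ : ℝ≥0∞ := 2 * (2 : ℝ≥0∞) ^ (1 / 2 : ℝ) with hc₀
  have hc₀top : c₀ ≠ ⊤ :=
    ENNReal.mul_ne_top (by norm_num) (ENNReal.rpow_ne_top_of_nonneg (by norm_num) (by norm_num))
  set ED : ℝ → ℝ≥0∞ := fun M => c₀ * K * (ENNReal.ofReal (B M) * ENNReal.ofReal (2 * |M|) +
    ENNReal.ofReal (B M) ^ (3 / 2 : ℝ)) with hED
  have hEDtop : ∀ M, ED M ≠ ⊤ := fun M =>
    ENNReal.mul_ne_top (ENNReal.mul_ne_top hc₀top hKtop) (ENNReal.add_ne_top.2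
      ⟨ENNReal.mul_ne_top ENNReal.ofReal_ne_top ENNReal.ofReal_ne_top,
        ENNReal.rpow_ne_top_of_nonneg (by norm_num) ENNReal.ofReal_ne_top⟩)
  refine ⟨fun M => (ED M).toReal, fun M => ENNReal.toReal_nonneg, ?_⟩
  intro M T τ u p hcl0 hEx hτ hrate hT x
  rw [ENNReal.ofReal_toReal (hEDtop M)]
  -- data
  have hcl : IsClassicalNSSolutionOn (Ioo 0 T) 1 0 u p :=
    hcl0.mono Ioo_subset_Icc_self (uniqueDiffOn_Ioo 0 T)
  obtain ⟨E₀, hE₀, hE⟩ := id hEx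
  set m : ℝ → ℝ := fun s => |M| * (max (T + τ - s) τ) ^ (-(1 / 2 : ℝ)) with hm
  have hm0 : ∀ s, 0 ≤ m s := typeIWeight_nonneg M T hτ
  have humT : ∀ t ∈ Icc 0 T, ∀ y, ‖u t y‖ ≤ m t := fun t ht y =>
    norm_le_typeIWeight hτ ht.2 (hrate t ht y)
  have hmbar : ∀ t ∈ Icc 0 T, ∀ y, ‖u t y‖ ≤ |M| * τ ^ (-(1 / 2 : ℝ)) := fun t ht y =>
    (humT t ht y).trans (typeIWeight_le M T hτ t)
  have hp := pressure_normalised_of_classical hcl0 hEx hmbar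
  have hAx := hA hcl0 hEx hτ hrate hT
  set A : ℝ≥0∞ := ENNReal.ofReal (B M) with hAdef
  have hV0 : volume (ball x 1) ≠ 0 := (measure_ball_pos volume x one_pos).ne'
  have hVtop : volume (ball x 1) ≠ ⊤ := measure_ball_lt_top.ne
  -- ## the slice bound on interior times
  have hslice : ∀ t ∈ Ioo (T - 1) T,
      ∫⁻ y in ball x 1, ENNReal.ofReal (|p t y - ⨍ z in ball x 1, p t z| ^ (3 / 2 : ℝ)) ≤
        c₀ * K * (ENNReal.ofReal (m t) * A + A ^ (3 / 2 : ℝ)) := by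
    intro t ht
    have htI : t ∈ Icc 0 T := ⟨by linarith [ht.1], ht.2.le⟩
    have htS : t ∈ Ioo 0 T := ⟨by linarith [ht.1], ht.2⟩
    have hwc : Continuous (u t) := (hcl.contDiff_velocity htS).continuous
    have hw2 : MemLp (u t) 2 volume := memLp_two_of_lintegral_ne_top hwc
      (ne_top_of_le_ne_top hE₀ (hE t htI))
    have hw3 : MemLp (u t) 3 volume := memLp_three_of_memLp_two_of_norm_le hw2 (humT t htI)
    have hball : ∀ z : EuclideanSpace ℝ (Fin 3), ∫⁻ y in ball z 1, ‖u t y‖ₑ ^ 2 ≤ A :=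
      fun z => (hAx z).1 t ⟨ht.1.le, ht.2.le⟩
    obtain ⟨κ, -, hκ⟩ := hK (u t) hw3 (m t) (hm0 t) (humT t htI) A hball x
    obtain ⟨C, hC⟩ := hp t htS
    -- integrability of the pressure slice on the ball
    have hpi : IntegrableOn (p t) (ball x 1) volume :=
      ((hcl.contDiff_pressure htS).continuous.continuousOn.integrableOn_compact
        (isCompact_closedBall x 1)).mono_set ball_subset_closedBall
    -- oscillation about the mean ≤ 2√2 × oscillation about `C + κ`
    have hosc := RRS2016.lintegral_enorm_sub_setAverage_rpow_le hV0 hVtop hpi (C + κ)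
    calc ∫⁻ y in ball x 1, ENNReal.ofReal (|p t y - ⨍ z in ball x 1, p t z| ^ (3 / 2 : ℝ))
        = ∫⁻ y in ball x 1, ‖p t y - ⨍ z in ball x 1, p t z‖ₑ ^ (3 / 2 : ℝ) := by
          refine lintegral_congr fun y => ?_
          rw [← ENNReal.ofReal_rpow_of_nonneg (abs_nonneg _) (by norm_num), ← Real.enorm_eq_ofReal_abs]
      _ ≤ 2 * 2 ^ (1 / 2 : ℝ) * ∫⁻ y in ball x 1, ‖p t y - (C + κ)‖ₑ ^ (3 / 2 : ℝ) := hosc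
      _ = c₀ * ∫⁻ y in ball x 1, ‖rieszPressure (u t) y - κ‖ₑ ^ (3 / 2 : ℝ) := by
          rw [hc₀]
          congr 1
          refine lintegral_congr_ae ?_
          filter_upwards [ae_restrict_of_ae (s := ball x 1) hC] with y hy
          rw [hy, show rieszPressure (u t) y + C - (C + κ) = rieszPressure (u t) y - κ by ring]
      _ ≤ c₀ * ∫⁻ y in ball x 3, ‖rieszPressure (u t) y - κ‖ₑ ^ (3 / 2 : ℝ) :=
          mul_le_mul' le_rfl (lintegral_mono_set (ball_subset_ball (by norm_num)))
      _ ≤ c₀ * (K * (ENNReal.ofReal (m t) * A + A ^ (3 / 2 : ℝ))) := mul_le_mul' le_rfl hκ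
      _ = c₀ * K * (ENNReal.ofReal (m t) * A + A ^ (3 / 2 : ℝ)) := by ring
  -- ## integrate over `(T - 1, T)`
  have hmc : Continuous m := continuous_typeIWeight M T hτ
  have hmeas : Measurable fun t => ENNReal.ofReal (m t) := ENNReal.measurable_ofReal.comp hmc.measurable
  have hmi : IntegrableOn m (Ioo (T - 1) T) volume :=
    (hmc.continuousOn.integrableOn_compact isCompact_Icc).mono_set Ioo_subset_Icc_self
  have hint_m : ∫⁻ t in Ioo (T - 1) T, ENNReal.ofReal (m t) ≤ ENNReal.ofReal (2 * |M|) := by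
    rw [← ofReal_integral_eq_lintegral_ofReal hmi (ae_of_all _ hm0)]
    refine ENNReal.ofReal_le_ofReal ?_
    have h := integral_typeIWeight_le (M := M) (T := T) hτ (le_refl (T - 1)) (by linarith) le_rfl
    rw [intervalIntegral.integral_of_le (by linarith), integral_Ioc_eq_integral_Ioo] at h
    exact h
  have hvol : volume (Ioo (T - 1) T) = 1 := by
    rw [Real.volume_Ioo, show T - (T - 1) = 1 by ring, ENNReal.ofReal_one]
  calc ∫⁻ t in Icc (T - 1) T, ∫⁻ y in ball x 1,
        ENNReal.ofReal (|p t y - ⨍ z in ball x 1, p t z| ^ (3 / 2 : ℝ))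
      = ∫⁻ t in Ioo (T - 1) T, ∫⁻ y in ball x 1,
          ENNReal.ofReal (|p t y - ⨍ z in ball x 1, p t z| ^ (3 / 2 : ℝ)) :=
        setLIntegral_congr Ioo_ae_eq_Icc.symm
    _ ≤ ∫⁻ t in Ioo (T - 1) T, c₀ * K * (ENNReal.ofReal (m t) * A + A ^ (3 / 2 : ℝ)) :=
        lintegral_mono_ae ((ae_restrict_mem measurableSet_Ioo).mono hslice)
    _ = c₀ * K * (A * ∫⁻ t in Ioo (T - 1) T, ENNReal.ofReal (m t)) +
          c₀ * K * A ^ (3 / 2 : ℝ) * volume (Ioo (T - 1) T) := by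
        have e : ∀ t, c₀ * K * (ENNReal.ofReal (m t) * A + A ^ (3 / 2 : ℝ)) =
            c₀ * K * A * ENNReal.ofReal (m t) + c₀ * K * A ^ (3 / 2 : ℝ) := fun t => by ring
        simp_rw [e]
        rw [lintegral_add_right _ measurable_const, lintegral_const_mul _ hmeas, lintegral_const,
          Measure.restrict_apply_univ]
        ring
    _ ≤ c₀ * K * (A * ENNReal.ofReal (2 * |M|)) + c₀ * K * A ^ (3 / 2 : ℝ) * 1 := by
        rw [hvol]
        gcongr
    _ = ED M := by rw [hED]; ring

end Summit.NavierStokesRegularity.NavierStokesRegularity.Theorems.ThinCascade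

end
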